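import Mathlib
import HarnessLib
import Summits.ResolutionOfSingularities.ResolutionOfSingularities.Theorems.WildQuotientsWildQuotientResolutionInertLocusStalk

/-!
# Codimension of the reduced inert locus of a tame subgroup: number of independent differentials of the fixed-locus ideal
# (crux `WildQuotients.WildQuotientResolution`, stub `stub_phaseZeroHighDim`; any dimension)

Crux stmt-ResolutionOfSingularities-15640 (`WildQuotientResolution`), registered stub `stub_phaseZeroHighDim`.
Complement to ✓`InertLocusStalk` (p819500) / ✓`InertLocusCentre` (p819658) / ✓`tameMove` (p819797): at a point
`x` of the inert locus `Z_K` of a tame subgroup `K` with regular local ring, the stalk `(𝓘_{Z_K})_x` is generated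
by a finite set `s` of elements — a part of a regular system of parameters — with
`#s + dim (𝒪_{X,x} ⧸ (𝓘_{Z_K})_x) = dim 𝒪_{X,x}`: the codimension of `Z_K` at `x` is the number `#s` of independent
differentials of the fixed-locus ideal (= the number of non-trivial characters of `K` on the cotangent space,
✓`TameMoveEigen`/✓`NpcTameElement`). This is the shape of the hypothesis `hcodim` of ✓`CurveStep.curveMove`
(`dim (𝒪_z ⧸ 𝒥_z) + 2 = dim 𝒪_z`: the centre is a curve on a threefold) and of the point move (`#s = dim`).

[OURS · crux stmt-ResolutionOfSingularities-15640 · helper toward `stub_phaseZeroHighDim`; folklore, counted 0;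
AI-level work, weaker than expert review.] [folklore]
-/

-- single-problem summit: the doubled namespace component `ResolutionOfSingularities` is forced
set_option linter.dupNamespace false

noncomputable section

namespace Summit.ResolutionOfSingularities.ResolutionOfSingularities.Theorems.WildQuotientResolution.InertLocusStalk

open CategoryTheory AlgebraicGeometry TopologicalSpace IsLocalRing
open Literature.AlgebraicGeometry.Resolution Literature.AlgebraicGeometry.Ramification

universe u

variable {X : Scheme.{u}} {G : Type*} [Group G] (σ : G →* Aut X) (x : X) {I : Subgroup G}
  (a : I → (X.presheaf.stalk x ⟶ X.presheaf.stalk x))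
  (τ : I →* (X.presheaf.stalk x ≃+* X.presheaf.stalk x))
  (hkey : ∀ g : I, Spec.map (a g) ≫ X.fromSpecStalk x = X.fromSpecStalk x ≫ (σ (g : G)).hom)
  (hτ : ∀ (g : I) (r : X.presheaf.stalk x), τ g r = (a g⁻¹).hom r)
  {K : Subgroup G} (hK : K ≤ I) [Finite K] [IsRegularLocalRing (X.presheaf.stalk x)]

include hkey hτ hK

/-- **Codimension of the tame inert locus**: for `𝒪_{X,x}` regular, `|K|` invertible in it and `x ∈ Z_K`, the stalk
`(𝓘_{Z_K})_x` is spanned by a finite set `s ⊆ (𝓘_{Z_K})_x` with `#s + dim (𝒪_{X,x} ⧸ (𝓘_{Z_K})_x) = dim 𝒪_{X,x}`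
(✓`TameFixedLocus.isRegularLocalRing_quotient_and_exists_finset` through
✓`stalkIdeal_vanishingIdeal_inertLocus_of_isUnit`). [folklore] -/
theorem exists_finset_span_eq_stalkIdeal_inertLocus
    (hKu : IsUnit ((Nat.card K : ℕ) : X.presheaf.stalk x))
    (hx : K ≤ inertiaSubgroup σ x) (hZ : IsClosed {y : X | K ≤ inertiaSubgroup σ y}) :
    ∃ s : Finset (X.presheaf.stalk x),
      (↑s : Set (X.presheaf.stalk x)) ⊆
        ↑(stalkIdeal (Scheme.IdealSheafData.vanishingIdeal ⟨{y : X | K ≤ inertiaSubgroup σ y}, hZ⟩) x) ∧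
      Ideal.span (s : Set (X.presheaf.stalk x)) =
        stalkIdeal (Scheme.IdealSheafData.vanishingIdeal ⟨{y : X | K ≤ inertiaSubgroup σ y}, hZ⟩) x ∧
      (s.card : WithBot ℕ∞) + ringKrullDim (X.presheaf.stalk x ⧸
        stalkIdeal (Scheme.IdealSheafData.vanishingIdeal ⟨{y : X | K ≤ inertiaSubgroup σ y}, hZ⟩) x) =
        ringKrullDim (X.presheaf.stalk x) := by
  have hm : (⨆ k : K, augIdeal ((τ.comp (Subgroup.inclusion hK)) k)) ≤
      maximalIdeal (X.presheaf.stalk x) :=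
    (mem_inertLocus_iff_iSup_augIdeal_le σ x a τ hkey hτ hK).mp hx
  rw [stalkIdeal_vanishingIdeal_inertLocus_of_isUnit σ x a τ hkey hτ hK hKu hx hZ]
  exact (TameFixedLocus.isRegularLocalRing_quotient_and_exists_finset
    (τ.comp (Subgroup.inclusion hK)) hKu hm).2

/-- The same in the `curveMove` format: `dim (𝒪_{X,x} ⧸ (𝓘_{Z_K})_x) + c = dim 𝒪_{X,x}` for the number `c` of
elements of a part of a regular system of parameters generating the fixed-locus ideal. [folklore] -/
theorem exists_ringKrullDim_quotient_stalkIdeal_inertLocus_add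
    (hKu : IsUnit ((Nat.card K : ℕ) : X.presheaf.stalk x))
    (hx : K ≤ inertiaSubgroup σ x) (hZ : IsClosed {y : X | K ≤ inertiaSubgroup σ y}) :
    ∃ (c : ℕ) (f : Fin c → X.presheaf.stalk x), IsRsopPart f ∧
      Ideal.span (Set.range f) =
        stalkIdeal (Scheme.IdealSheafData.vanishingIdeal ⟨{y : X | K ≤ inertiaSubgroup σ y}, hZ⟩) x ∧
      ringKrullDim (X.presheaf.stalk x ⧸
        stalkIdeal (Scheme.IdealSheafData.vanishingIdeal ⟨{y : X | K ≤ inertiaSubgroup σ y}, hZ⟩) x) +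
        ((c : ℕ) : WithBot ℕ∞) = ringKrullDim (X.presheaf.stalk x) := by
  have hm : (⨆ k : K, augIdeal ((τ.comp (Subgroup.inclusion hK)) k)) ≤
      maximalIdeal (X.presheaf.stalk x) :=
    (mem_inertLocus_iff_iSup_augIdeal_le σ x a τ hkey hτ hK).mp hx
  rw [stalkIdeal_vanishingIdeal_inertLocus_of_isUnit σ x a τ hkey hτ hK hKu hx hZ]
  obtain ⟨c, f, -, hspan, hrsop⟩ :=
    TameFixedLocus.exists_isRsopPart_span_eq_iSup_augIdeal (τ.comp (Subgroup.inclusion hK)) hKu hm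
  refine ⟨c, f, hrsop, hspan, ?_⟩
  rw [← hspan]
  exact hrsop.ringKrullDim_quotient_add

end Summit.ResolutionOfSingularities.ResolutionOfSingularities.Theorems.WildQuotientResolution.InertLocusStalk

end
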